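import Summits.QuantumFields.YangMills.Theorems.UnitScaleTiltFluctuationComparisonRegPrGlobalSlackLegNaturalRowsTwoRunDoorSelCoherent
import Summits.QuantumFields.YangMills.Theorems.UnitScaleTiltFluctuationComparisonRegPrGlobalSlackLegNaturalChartKernelTwoRun
import HarnessLib

/-!
# `UnitScaleTiltFluctuationComparisonRegPrGlobalSlackLegNaturalRowsTwoRunDoorPrint` — THE NATURAL-OBJECT DOOR OF 3⁗χ(v4) WITH EVERY LETTER PRINT-SHAPED: (43)-as-definition, (K_b), (K₀),
# locality, pointwise (43) decay, (New), (Lip♮), (Fine_b) (crux `FluctuationComparisonRegPrIntL`, stmt-QuantumFields-20520, skeleton v5kD, STUB 3⁗χ(v4) `stub_globalTwoRunSlackFamChiV4`;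
# LEAD ym-ust-20520-w2 g5, (B10) of ★★OWNER ACK 50 (4)/51 (2) «GO-(B)»; count-neutral helper, def-free, registry untouched)

WHY.  ✓p639371 `k1aLegRowsDisplayTwoRunChiAtV4_of_kernelRowsSel_of_loc_ker_of_newLevel_fine` (`…TwoRunDoorSelCoherent`, this seat) displays, at the natural objects with a
run-coherent anchor, the chart two-run row (K) `FlatKernelLegCauchyΦ`[Φ♮] monolithically and the kernel letter (k) as a summed budget.  ym-inputs-p11 g4's
✓`…NaturalChartKernelTwoRun` splits (K)[Φ♮] into (K_b) (the BIRTH charts off the blocks — record level) and (K₀) (print's kernels across the two cut-offs, POINTWISE —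
[King1986] Prop. 3.6's shape for the kernels themselves): ✓`flatKernelLegCauchyΦ_naturalChart_chiV4_of_offBlock_of_pointwise`; this seat's ✓p636084 turns print's pointwise
(43) decay (k₀) into the budget (k).  THIS FILE composes them into ONE door whose every displayed letter is print-shaped:

* ★★★★★ **`k1aLegRowsDisplayTwoRunChiAtV4_of_printRows`**: display ⇐ `hsel`, `hcoh` ∧ ∃ `κ′ < κ₁`, `R`, `C₀ A₁ A ≥ 0`, `b ≥ 2, ≥ a+1`, `L_Φ C_f ≥ 0`, `C_N`, `γB > 0`, ∀ F γ ≤ γB,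
  `OfV4ChiAt` → ∃ p coherent, ∃ N: (43) · (K_b) · (K₀) · (ℓ) · (k₀) · ∃ δ: (New) · (Lip♮) · (Fine_b).
  RESIDUE READING: (43) is the definition of `oldVal`; (K_b), (ℓ), (k₀), (New) are rows of the (α) record / its definer; (Lip♮) is a theorem of the tree (p12 g7); the UNPRINTED
  content of the DECIDING crux for non-abelian `d = 3` is exactly (K₀) + (Fine_b) — Bałaban's previous-scale kernels and constrained minimisers at two successive cut-offs agree to
  order `(L^{−scale})^a` (E2 = NO).

HONEST SCOPE.  A composition of landed reductions; every listed row is a HYPOTHESIS, not asserted; nothing of [Balaban1985UV3] / [King1986] is asserted; no stub / crux / registry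
object touched (`--supports stmt-QuantumFields-20520`); no summit / rung / gap claim (YM₃ on T³ is ladder rung R3, not the Clay problem).  L-floor: none beyond `1 < L`; `L < M₁` is
print's big-block letter.

References: T. Bałaban, CMP 102 (1985) 255–275 [Balaban1985UV3] (p.263 L4, (24)–(25) p.262, (27)–(30) p.263, (33)–(34) p.264, (43)–(45) pp.266–267, (59)–(63) pp.270–272); C. King,
CMP 102 (1986) 649–677 [King1986] (Thm 3.4 (3.9) p.656, Prop. 3.6 (3.56) p.662, Prop. 3.9 (3.71)–(3.74) p.665); CMP 109 (1987) 249–301 [Balaban1987RG1] ((0.1) p.251).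
-/

set_option autoImplicit false

noncomputable section

open scoped Matrix.Norms.L2Operator Nat
open Literature.MathematicalPhysics.QuantumFieldTheory.Balaban1983to89
open Literature.MathematicalPhysics.QuantumFieldTheory.Balaban1983to89.T3ContinuumYM3Torus
open Literature.MathematicalPhysics.QuantumFieldTheory.Balaban1983to89.T3UnitLawDensityEML (ℰp)
open Literature.MathematicalPhysics.QuantumFieldTheory.Balaban1983to89.T3UnitScaleTilt (θBal)
open Literature.MathematicalPhysics.QuantumFieldTheory.Balaban1983to89.T3LevelShift (fieldShift)
open Literature.MathematicalPhysics.QuantumFieldTheory.Balaban1983to89.T3AlphaInputsAC (AlphaDataT3)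
open Literature.MathematicalPhysics.QuantumFieldTheory.Balaban1983to89.T3AlphaPolymerSocket (refineSet)
open Literature.MathematicalPhysics.QuantumFieldTheory.Balaban1983to89.TreeLengthTorus (tsys)
open Literature.MathematicalPhysics.QuantumFieldTheory.Balaban1983to89.B10Eq27TorusAxialLog
open Literature.MathematicalPhysics.QuantumFieldTheory.Balaban1983to89.B7Prop1Explicit (l1)
open Literature.MathematicalPhysics.QuantumFieldTheory.Balaban1983to89.ExpMeanLog (deltaSU deltaSU_pos)
open Literature.MathematicalPhysics.QuantumFieldTheory.Balaban1985CMP102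
open Literature.MathematicalPhysics.QuantumFieldTheory.Balaban1985CMP102.Setting
open Literature.MathematicalPhysics.QuantumFieldTheory.Balaban1985CMP102.Binders (ChartAnalyticityAsCited)
open Summit.QuantumFields.Balaban3D.Carriers
open Summit.QuantumFields.Balaban3D.Proofs.Primitives
open Summit.QuantumFields.Balaban3D.Proofs.GroupModelLieC (vecE lieC)
open Summit.QuantumFields.YangMills.Theorems
open Summit.QuantumFields.YangMills.Theorems.GlobalSlackKernelMatching
open Summit.QuantumFields.YangMills.Theorems.GlobalSlackCanonicalPolymers

namespace Summit.QuantumFields.YangMills.Theorems.GlobalSlackKernelLeg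

variable (sel : (F : T3Family) → (K b : ℕ) → Set (Site (F.P K) 0) → Site (F.P K) b)
  (hsel : ∀ (F : T3Family) (K b : ℕ) (Y : Set (Site (F.P K) 0)), sel F K b Y ∈ anchors K b Y)

include hsel

/-! ## §1 The print-shaped door -/

open Classical in
/-- ★★★★★ **THE TWO-RUN DISPLAY OF 3⁗χ(v4) AT THE NATURAL OBJECTS, EVERY LETTER PRINT-SHAPED**: `1 < L < 𝔠.M₁`, `p₁ ≥ p₀ + r₀`, a RUN-COHERENT anchor selector; for every family,
coupling `γ ≤ γB` and inhabited χ-package a coherent `p` and a leg-indexed `𝔤ᶜ`-kernel family `N` with: (43) the record's old terms ARE the kernel polynomials at `B♮[sel]`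
(definition of `oldVal`, [Balaban1985UV3] (43)); (K_b) the birth charts' two-run kernel row off the blocks; **(K₀)** the KERNELS of runs `K`, `K+1` agree —
`‖N (K+1) (b+1) (liftSite y) n (matchBond ∘ c) − N K b y n c‖ ≤ A₁·Πᵢe^{−κ₁d(cᵢ)}·(L^{−(1+b)})^a` ([King1986] Prop. 3.6's shape; UNPRINTED for non-abelian `d = 3`); (ℓ) locality (p.263 L4);
(k₀) print's pointwise (43) decay; and a fine distance `δ` with (New) (the record's `Bcfg` across the two runs at the new chart level), (Lip♮) (Lipschitz of the old-level loop
variable; a theorem of the tree by ym-inputs-p12 g7), **(Fine_b)** the constrained minimisers of runs `K`, `K+1` over the same coarse field are close ([King1986] Prop. 3.9's shape;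
UNPRINTED).  THEN `K1aLegRowsDisplayTwoRunChiAtV4 L 𝔠 a₀ a₁ a p₁` — by ✓p639371 with (K) from p11 g4's ✓`flatKernelLegCauchyΦ_naturalChart_chiV4_of_offBlock_of_pointwise` and (k) from
✓`kernelBudget_of_pointwise`.  With ✓`InteriorExcision.regPrIntL_of_halving_exist_recChiV4_k1aLegRowsDisplayTwoRunChiAtV4_allL` this is the natural-object form of the DECIDING crux:
beyond 19200's leaves and the NODE-O record its unprinted content is exactly (K₀) + (Fine_b).
[cite: Balaban1985UV3, p.263 L4, (24)-(25) p.262, (27)-(30) p.263, (33)-(34) p.264, (43)-(45) pp.266-267, (59)-(63) pp.270-272; King1986, Prop. 3.6 (3.56) p.662, Prop. 3.9 (3.71)-(3.74) p.665; Balaban1987RG1, (0.1) p.251] -/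
theorem k1aLegRowsDisplayTwoRunChiAtV4_of_printRows {L : ℕ} (hL : 1 < L) {𝔠 : AlphaConsts L (suGroupModel 2).N} (hM : L < 𝔠.M₁) {a₀ a₁ a p₁ : ℝ}
    (ha₀ : 0 < a₀) (ha₁ : 0 < a₁) (hp₁ : 𝔠.p₀ + 𝔠.r₀ ≤ p₁)
    (hcoh : ∀ (F : T3Family) (K b : ℕ) (Y : Set (Site (F.P K) 0)), sel F (K + 1) (b + 1) (refineSet F K Y) = liftSite F K b (sel F K b Y))
    (h : ∃ (κ' κ₁ R C₀ A₁ A b L_Φ C_f C_N γB : ℝ), 0 < κ' ∧ κ' < κ₁ ∧ 0 ≤ C₀ ∧ 0 ≤ A₁ ∧ 0 ≤ A ∧ 2 ≤ b ∧ a + 1 ≤ b ∧ 0 ≤ L_Φ ∧ 0 ≤ C_f ∧ 0 < γB ∧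
      ∀ (F : T3Family) (γ : ℝ) (hF : F.L = L) (hγ : 0 < γ), γ ≤ γB → ∀ (hγ1 : γ ≤ (min (hF ▸ 𝔠).gamma0 1) ^ 2),
        AlphaInputsT3AC.OfV4ChiAt F (hF ▸ 𝔠) a₀ a₁ →
          ∃ (p : ∀ K, AlphaInputsT3AC.PkgAtV4Chi F (hF ▸ 𝔠) γ hγ hγ1 K), (∀ K, (p K).a₀ = a₀ ∧ (p K).a₁ = a₁) ∧
            ∃ (N : (K b : ℕ) → Site (F.P K) (1 + b) → (n : ℕ) → (Fin n → PBond (F.P K) b) →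
                ContinuousMultilinearMap ℂ (fun _ : Fin n => ↥(lieC (suGroupModel 2))) ℂ),
              (∀ (K k : ℕ), k + 1 ≤ K → ∀ j : ℕ, j < k →
                ∀ y ∈ oldBlocks (hF ▸ 𝔠).lane.carrier.M₁ (rcolOf (SK F (hF ▸ 𝔠) γ hγ hγ1 K) (hF ▸ 𝔠).lane.carrier) (Hist.triv (F.P K) (k + 1)) (1 + j),
                  ∀ W : GaugeField (F.P K) (k + 1) (Matrix.specialUnitaryGroup (Fin 2) ℂ),
                    oldTermRows (fun K => (p K).toRows) K k (1 + j) y W =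
                      (∑ n ∈ Finset.Ico 2 7, ((n ! : ℂ))⁻¹ * ∑ c : Fin n → PBond (F.P K) j, N K j y n c (fun i =>
                        (fun K k b Y W c =>
                          if h : b + 1 = k then birthCfgAtRows (fun K => (p K).toRows) K b Y (h ▸ W) c
                          else if (l1 (rel (sel F K b Y) c.src) : ℝ) *
                              (2 * ((hF ▸ 𝔠).B₃ * θBal F.L γ (hF ▸ 𝔠).b₀ p₁ (K - k)) * (((F.L : ℝ) ^ (k - b))⁻¹) ^ 2) ≤ 1 / 2 then
                            (lieC (suGroupModel 2)).orthogonalProjectionOnto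
                              (vecE (suGroupModel 2).N
                                (B27T (unitsField (toUField (Averaging.iter (fun i => BlockAveraging.blockAvg (P := F.P K) (j := i) ℰp) b
                                  ((p K).UkH k (Hist.triv (F.P K) k) W)))) (sel F K b Y) c))
                          else 0) K (k + 1) j (blockSet K (1 + j) y) W (c i))).re) ∧
              -- (K_b) the two-run kernel row of the BIRTH charts off the blocks (record level)
              (∀ (K k b : ℕ) (Y : Set (Site (F.P K) 0)), Y ∈ canonLocRows (fun K => (p K).toRows) K k (Hist.triv (F.P K) k) (1 + b) →
                (∀ y : Site (F.P K) (1 + b), blockSet K (1 + b) y ≠ Y) → ∀ d ∈ Finset.Ico 2 7,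
                  ‖(kerT (birthChartRows fun K => (p K).toRows) K b Y d - ker (birthChartRows fun K => (p K).toRows) K b Y d).compContinuousLinearMap
                      fun _ => legL ↥(lieC (suGroupModel 2)) (canonLegDist F) κ' K b Y‖ ≤
                    C₀ * Real.exp (-(hF ▸ 𝔠).κ * (AlphaInputsT3AC.dataOfV4chi p (canonPolymerRows fun K => (p K).toRows)).treeLen K (1 + b) Y) *
                      (((F.L : ℝ) ^ (1 + b))⁻¹) ^ a) ∧
              -- (K₀) print's KERNELS ACROSS THE TWO CUT-OFFS, pointwise ([King1986] Prop. 3.6's shape) — UNPRINTED for non-abelian d = 3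
              (∀ (K k b : ℕ) (y : Site (F.P K) (1 + b)), blockSet K (1 + b) y ∈ canonLocRows (fun K => (p K).toRows) K k (Hist.triv (F.P K) k) (1 + b) →
                ∀ n ∈ Finset.Ico 2 7, ∀ c : Fin n → PBond (F.P K) b,
                  ‖N (K + 1) (b + 1) (liftSite F K (1 + b) y) n (fun i => matchBond F K b (c i)) - N K b y n c‖ ≤
                    A₁ * (∏ i, Real.exp (-(κ₁ * canonLegDist F K b (blockSet K (1 + b) y) (c i)))) * (((F.L : ℝ) ^ (1 + b))⁻¹) ^ a) ∧
              -- (ℓ) locality of the retained charts at leg distance `R`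
              (∀ (K b : ℕ), b + 1 ≤ K → ∀ X ∈ newDomsRows (fun K => (p K).toRows) K b (Hist.triv (F.P K) (b + 1)),
                ∀ z : PBond (F.P K) b → ↥(lieC (suGroupModel 2)),
                  (((p K).toRows).𝔖 b).Ψ X z =
                    (((p K).toRows).𝔖 b).Ψ X (fun c => if canonLegDist F K b (domSet (F := F) (hF ▸ 𝔠).lane.carrier.M₁ K b X) c ≤ R then z c else 0) ∧
                  (((p K).toRows).𝔄.Λc b).Ψ X z =
                    (((p K).toRows).𝔄.Λc b).Ψ X (fun c => if canonLegDist F K b (domSet (F := F) (hF ▸ 𝔠).lane.carrier.M₁ K b X) c ≤ R then z c else 0)) ∧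
              -- (k₀) print's POINTWISE (43) decay of the kernels at the listed blocks, rate `κ₁ > κ′`
              (∀ (K k b : ℕ) (y : Site (F.P K) (1 + b)),
                blockSet K (1 + b) y ∈ canonLocRows (fun K => (p K).toRows) K k (Hist.triv (F.P K) k) (1 + b) →
                  ∀ n ∈ Finset.Ico 2 7, ∀ c : Fin n → PBond (F.P K) b,
                    ‖N K b y n c‖ ≤ A * ∏ i, Real.exp (-(κ₁ * canonLegDist F K b (blockSet K (1 + b) y) (c i)))) ∧
              -- a fine distance functional of the supplier's choosing
              ∃ δ : (K k : ℕ) → GaugeField (F.P K) 0 (Matrix.specialUnitaryGroup (Fin 2) ℂ) → GaugeField (F.P K) 0 (Matrix.specialUnitaryGroup (Fin 2) ℂ) → ℝ,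
              -- (New) the two-run row at the NEW chart level only (both sides are the record's `Bcfg`: B0's coherence)
              (∀ (K n : ℕ) (h : n ≤ K), ∀ j : ℕ, j < K - n → j + 1 = K - n → ∀ V : GaugeField (F.P n) 0 (Matrix.specialUnitaryGroup (Fin 2) ℂ), PlaqSmall (θBal F.L γ (hF ▸ 𝔠).b₀ p₁ n) V →
        ∀ Y ∈ (AlphaInputsT3AC.dataOfV4chi p (canonPolymerRows fun K => (p K).toRows)).Loc K (K - n)
          ((AlphaInputsT3AC.dataOfV4chi p (canonPolymerRows fun K => (p K).toRows)).triv K (K - n)) (1 + j), ∀ c : PBond (F.P K) j,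
          ‖(fun K k b Y W c =>
        if h : b + 1 = k then birthCfgAtRows (fun K => (p K).toRows) K b Y (h ▸ W) c
        else if (l1 (rel (sel F K b Y) c.src) : ℝ) * (2 * ((hF ▸ 𝔠).B₃ * θBal F.L γ (hF ▸ 𝔠).b₀ p₁ (K - k)) * (((F.L : ℝ) ^ (k - b))⁻¹) ^ 2) ≤ 1 / 2 then
          (lieC (suGroupModel 2)).orthogonalProjectionOnto (vecE (suGroupModel 2).N (B27T (unitsField (toUField
            (Averaging.iter (fun i => BlockAveraging.blockAvg (P := F.P K) (j := i) ℰp) b ((p K).UkH k (Hist.triv (F.P K) k) W)))) (sel F K b Y) c))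
        else 0) (K + 1) (K + 1 - n) (j + 1) (refineSet F K Y)
                (fieldShift (F.sitesPerDir_eq (m := F.m) (K := K + 1) (j := K + 1 - n) (m' := F.m) (K' := n) (j' := 0) (by omega)) V) (matchBond F K j c) -
              (fun K k b Y W c =>
        if h : b + 1 = k then birthCfgAtRows (fun K => (p K).toRows) K b Y (h ▸ W) c
        else if (l1 (rel (sel F K b Y) c.src) : ℝ) * (2 * ((hF ▸ 𝔠).B₃ * θBal F.L γ (hF ▸ 𝔠).b₀ p₁ (K - k)) * (((F.L : ℝ) ^ (k - b))⁻¹) ^ 2) ≤ 1 / 2 then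
          (lieC (suGroupModel 2)).orthogonalProjectionOnto (vecE (suGroupModel 2).N (B27T (unitsField (toUField
            (Averaging.iter (fun i => BlockAveraging.blockAvg (P := F.P K) (j := i) ℰp) b ((p K).UkH k (Hist.triv (F.P K) k) W)))) (sel F K b Y) c))
        else 0) K (K - n) j Y
                (fieldShift (F.sitesPerDir_eq (m := F.m) (K := K) (j := K - n) (m' := F.m) (K' := n) (j' := 0) (by omega)) V) c‖ ≤
            C_N * (1 + canonLegDist F K j Y c) * θBal F.L γ (hF ▸ 𝔠).b₀ p₁ n * (((F.L : ℝ) ^ (K - n - 1 - j))⁻¹) ^ 2 * (((F.L : ℝ) ^ (1 + j))⁻¹) ^ a) ∧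
              -- (Lip♮) Lipschitz of the old-level loop variable between the two fine backgrounds
              (∀ (K n : ℕ) (h : n ≤ K), ∀ j : ℕ, j + 1 < K - n → ∀ V : GaugeField (F.P n) 0 (Matrix.specialUnitaryGroup (Fin 2) ℂ), PlaqSmall (θBal F.L γ (hF ▸ 𝔠).b₀ p₁ n) V →
        ∀ Y ∈ (AlphaInputsT3AC.dataOfV4chi p (canonPolymerRows fun K => (p K).toRows)).Loc K (K - n)
          ((AlphaInputsT3AC.dataOfV4chi p (canonPolymerRows fun K => (p K).toRows)).triv K (K - n)) (1 + j), ∀ c : PBond (F.P K) j,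
          ‖(fun K k b Y (U : GaugeField (F.P K) 0 (Matrix.specialUnitaryGroup (Fin 2) ℂ)) c =>
        if (l1 (rel (sel F K b Y) c.src) : ℝ) * (2 * ((hF ▸ 𝔠).B₃ * θBal F.L γ (hF ▸ 𝔠).b₀ p₁ (K - k)) * (((F.L : ℝ) ^ (k - b))⁻¹) ^ 2) ≤ 1 / 2 then
          (lieC (suGroupModel 2)).orthogonalProjectionOnto (vecE (suGroupModel 2).N (B27T (unitsField (toUField
            (Averaging.iter (fun i => BlockAveraging.blockAvg (P := F.P K) (j := i) ℰp) b U))) (sel F K b Y) c))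
        else 0) K (K - n) j Y ((p K).UkH (K - n) (Hist.triv (F.P K) (K - n)) (fieldShift (F.sitesPerDir_eq (m := F.m) (K := K) (j := K - n) (m' := F.m) (K' := n) (j' := 0) (by omega)) V)) c -
            (fun K k b Y (U : GaugeField (F.P K) 0 (Matrix.specialUnitaryGroup (Fin 2) ℂ)) c =>
        if (l1 (rel (sel F K b Y) c.src) : ℝ) * (2 * ((hF ▸ 𝔠).B₃ * θBal F.L γ (hF ▸ 𝔠).b₀ p₁ (K - k)) * (((F.L : ℝ) ^ (k - b))⁻¹) ^ 2) ≤ 1 / 2 then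
          (lieC (suGroupModel 2)).orthogonalProjectionOnto (vecE (suGroupModel 2).N (B27T (unitsField (toUField
            (Averaging.iter (fun i => BlockAveraging.blockAvg (P := F.P K) (j := i) ℰp) b U))) (sel F K b Y) c))
        else 0) K (K - n) j Y
              (fieldShift (F.sitesPerDir_eq (m := F.m) (K := K) (j := 0) (m' := F.m) (K' := K + 1) (j' := 1) (by omega)) ((BlockAveraging.blockAvg (P := F.P (K + 1)) (j := 0) ℰp).avg
                ((p (K + 1)).UkH (K + 1 - n) (Hist.triv (F.P (K + 1)) (K + 1 - n)) (fieldShift (F.sitesPerDir_eq (m := F.m) (K := K + 1) (j := K + 1 - n) (m' := F.m) (K' := n) (j' := 0) (by omega)) V)))) c‖ ≤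
            L_Φ * (1 + canonLegDist F K j Y c) * (F.L : ℝ) ^ j *
              δ K (K - n) ((p K).UkH (K - n) (Hist.triv (F.P K) (K - n)) (fieldShift (F.sitesPerDir_eq (m := F.m) (K := K) (j := K - n) (m' := F.m) (K' := n) (j' := 0) (by omega)) V))
                (fieldShift (F.sitesPerDir_eq (m := F.m) (K := K) (j := 0) (m' := F.m) (K' := K + 1) (j' := 1) (by omega)) ((BlockAveraging.blockAvg (P := F.P (K + 1)) (j := 0) ℰp).avg
                ((p (K + 1)).UkH (K + 1 - n) (Hist.triv (F.P (K + 1)) (K + 1 - n)) (fieldShift (F.sitesPerDir_eq (m := F.m) (K := K + 1) (j := K + 1 - n) (m' := F.m) (K' := n) (j' := 0) (by omega)) V))))) ∧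
              -- (Fine_b) the two fine backgrounds of runs `K`, `K+1` are close in the supplier's fine distance `δ`
              (∀ (K n : ℕ) (h : n ≤ K), 1 < K - n → ∀ V : GaugeField (F.P n) 0 (Matrix.specialUnitaryGroup (Fin 2) ℂ), PlaqSmall (θBal F.L γ (hF ▸ 𝔠).b₀ p₁ n) V →
        δ K (K - n) ((p K).UkH (K - n) (Hist.triv (F.P K) (K - n)) (fieldShift (F.sitesPerDir_eq (m := F.m) (K := K) (j := K - n) (m' := F.m) (K' := n) (j' := 0) (by omega)) V))
            (fieldShift (F.sitesPerDir_eq (m := F.m) (K := K) (j := 0) (m' := F.m) (K' := K + 1) (j' := 1) (by omega)) ((BlockAveraging.blockAvg (P := F.P (K + 1)) (j := 0) ℰp).avg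
                ((p (K + 1)).UkH (K + 1 - n) (Hist.triv (F.P (K + 1)) (K + 1 - n)) (fieldShift (F.sitesPerDir_eq (m := F.m) (K := K + 1) (j := K + 1 - n) (m' := F.m) (K' := n) (j' := 0) (by omega)) V)))) ≤
          C_f * θBal F.L γ (hF ▸ 𝔠).b₀ p₁ n * (((F.L : ℝ) ^ (K - n))⁻¹) ^ b)) :
    K1aLegRowsDisplayTwoRunChiAtV4 L 𝔠 a₀ a₁ a p₁ := by
  obtain ⟨κ', κ₁, R, C₀, A₁, A, b, L_Φ, C_f, C_N, γB, hκ', hκ₁, hC₀, hA₁, hA, hb2, hab, hLΦ, hCf, hγB, hall⟩ := h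
  have hρ0 : 0 ≤ 𝔠.ρ * Real.exp (-(κ' * R)) := (mul_pos 𝔠.ρ_pos (Real.exp_pos _)).le
  refine k1aLegRowsDisplayTwoRunChiAtV4_of_kernelRowsSel_of_loc_ker_of_newLevel_fine sel hsel hL hM ha₀ ha₁ hp₁ hcoh
    ⟨κ', R,
      max C₀ (A₁ * Real.exp (𝔠.κ * (L : ℝ) ^ 3) * ∑ n ∈ Finset.Ico 2 7, ((n ! : ℝ))⁻¹ * (legSumConst L 𝔠 (κ₁ - κ') * (1 + (L : ℝ) ^ 3) * 6) ^ n),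
      max (𝔠.C25 + 𝔠.C63) (A * Real.exp (𝔠.κ * (L : ℝ) ^ 3) *
        ∑ n ∈ Finset.Ico 2 7, ((n ! : ℝ))⁻¹ * (legSumConst L 𝔠 (κ₁ - κ') * (1 + (L : ℝ) ^ 3) * (𝔠.ρ * Real.exp (-(κ' * R)) / 2)) ^ n),
      b, L_Φ, C_f, C_N, γB, hκ', le_max_of_le_left hC₀, le_max_left _ _, hb2, hab, hLΦ, hCf, hγB, fun F γ hF hγ hγle hγ1 hOf => ?_⟩
  obtain ⟨p, hp, N, h43, hKb, hK0, hloc, hpt, δ, hNew, hLip, hFine⟩ := hall F γ hF hγ hγle hγ1 hOf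
  subst hF
  refine ⟨p, hp, N, h43, flatKernelLegCauchyΦ_naturalChart_chiV4_of_offBlock_of_pointwise p N hκ₁ hA₁ hKb hK0, hloc, fun K k b y hY => ?_,
    δ, hNew, hLip, hFine⟩
  have hb := kernelBudget_of_pointwise (fun K => (p K).toRows) N hκ₁ (kappa_record_admissible 𝔠).1.le hA hρ0 hpt K k b y hY
  exact hb.trans (mul_le_mul_of_nonneg_right (le_max_right _ _) (Real.exp_pos _).le)

end Summit.QuantumFields.YangMills.Theorems.GlobalSlackKernelLeg

end
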